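import Summits.MatrixMultiplication.OmegaCensus.STPPKernelBitsets
import Literature.Computability.AlgebraicComplexity.GroupTheoreticMatMul

/-!
# ω-census (abelian STPP census): the slack-2 partition CHECKERS for a one-other-block leaf (cases A / B′ and C), bitmask form (kernel tool)

HONEST FRAMING (pub-omega census; verbatim): lottery ticket; floor = certified bounds/negative ranges.
Census STRUCTURE (seat pub-omega-stpp-1 gen 32, 2026-08-28), family (b2).  The computational half of the slack-2 partition law (HOME
`pub-omega-stpp-1-g32/SLACK2-DESIGN.md`; shapes `STPPVosperSlackTwoShapes.lean`; bit sets `STPPKernelBitsets.lean`) for a leaf with ONE other block, e.g.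
`{(3,3,3),(3,3,4)} @ ℤ₆₁`.  Block `i = (P, Q, R′)` of sizes `(a, b, c)` in VALUES after the normalisation that uses all `N + 2 = 4` translation freedoms and the
dilation (`IsSTPP.translate`, `IsSTPP.shiftBC`): the Vosper side `P = [0, a)` (difference `1`), `0 ∈ Q` (global `B`-offset), `0 ∈ R′` (global `C`-offset),
`0 ∈ B′₀` (block-0 translation); the positions of `Y° = C′₀ − B′₀` (`L` points) and `Z° = C′₀ − A′₀` (`z` points) are then determined and SEARCHED; no `π`.
* `isSTPPb` — CKSU Def. 5.1 for a family of value lists (brute force);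
* `realisationsDead p a₀ b₀ c₀ P Q R Yo Zo` — no block `0 = (A′, B′, C′)` with `0 ∈ B′`, `C′ − B′ = Y°`, `C′ − A′ = Z°`, `A′ − B′` injective completes
  `(P, Q, R)` to an `isSTPPb` family;
* `tilesAll leaf k rest chosen cov` — the generic tiling loop (choose `k` more translates of the pattern, increasing positions, pairwise disjoint and
  disjoint from `cov`), `&&` of `leaf`;
* `caseADeadQ p a c L z a₀ b₀ c₀ Q` — CASE A (`#SY = a + L − 1`: `SY = [s0, s0 + a + L − 1)`, `Y° = [s0 + a − 1, …)`, `Z° ⊆ Zc = ⋂_{q∈Q}(Tfree + q)`) is dead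
  for the free shape `Q` (case B′ = case A of the role-swapped family); `caseCDeadQP p c L z a₀ b₀ c₀ Q P` — CASE C (both pairs one above
  Cauchy–Davenport, Hamidoune–Rødseth shapes `Q = [0,b]∖{h}`, `P = d·([0,a]∖{h′})`, `Z°` a `(z+1)`-interval minus a hole, partition exact);
* shape lists `qShapes`, `qShapesC`, `pShapesC`, and the symmetry quotient `canonShapes p b g1` (bracelet-canonical GAP sequences: rotation = which
  element of `Bᵢ` is sent to `0`, reflection = the automorphism `−1`), chunked by the smallest gap `g1`;
* soundness pieces proved here: `tilesAll_complete` (the loop reaches every admissible tiling), `lexLE`-free facts about the loop; the checkers' full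
  soundness (`…_sound`) is the successor's item (plan in HOME SLACK2-DESIGN.md §SOUNDNESS PLAN).
VALIDATION (python ×1 ↔ Lean `#eval`, every counter equal): case A over the 1 770 three-shapes (35 856, 72, 1 206, 54, 0), case B′ over the 34 220 four-shapes
(177 936, 48, 264, 0, 0), case C (13 272, 78 660, 58 464, 204, 480, 0, 0); KERNEL (`decide +kernel`): 50 three-shapes ≈ 30–45 s, 225 canonical four-shapes 96 s,
40 case-C pairs ≤ 40 s ⇒ the whole `{333,334} @ ℤ₆₁` computation ≈ 2 100 s in ≈ 25 declarations.  Nothing here is progress on `ω`.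

References: H. Cohn, R. Kleinberg, B. Szegedy, C. Umans, FOCS 2005 (arXiv:math/0511460), Def. 5.1; A. G. Vosper, J. London Math. Soc. 31 (1956);
Y. O. Hamidoune, Ø. J. Rødseth, Acta Arith. 92 (2000).
-/

namespace Summit.MatrixMultiplication.OmegaCensus.CubeNB.S2

open Summit.MatrixMultiplication.OmegaCensus.CubeNB.Bits

/-! ## §1 Def 5.1 in values and the realisation stage -/

/-- **CKSU Def. 5.1 for value lists** (all values `< p`): for all `i j k`, `s ∈ A_k`, `s′ ∈ A_i`, `t ∈ B_i`, `t′ ∈ B_j`, `u ∈ C_j`, `u′ ∈ C_k`,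
`(s′ − s) + (t′ − t) + (u′ − u) ≡ 0 (mod p)` implies `i = j = k`, `s = s′`, `t = t′`, `u = u′`. [cite: CohnKleinbergSzegedyUmans2005, Def. 5.1] -/
def isSTPPb (p : ℕ) (bl : List (List ℕ × List ℕ × List ℕ)) : Bool :=
  let n := bl.length
  let e : List ℕ × List ℕ × List ℕ := ([], [], [])
  (List.range n).all fun i => (List.range n).all fun j => (List.range n).all fun k =>
    let Ai := (bl.getD i e).1
    let Ak := (bl.getD k e).1
    let Bi := (bl.getD i e).2.1
    let Bj := (bl.getD j e).2.1
    let Cj := (bl.getD j e).2.2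
    let Ck := (bl.getD k e).2.2
    Ak.all fun s => Ai.all fun s' => Bi.all fun t => Bj.all fun t' => Cj.all fun u => Ck.all fun u' =>
      !(Nat.beq ((s' + t' + u' + 3 * p - s - t - u) % p) 0) || (Nat.beq i j && Nat.beq j k && Nat.beq s s' && Nat.beq t t' && Nat.beq u u')

/-- **No realisation of the other block completes an STPP family.**  Other block `(A′, B′, C′)` of sizes `(a₀, b₀, c₀)` with `0 ∈ B′` (so `C′ ⊆ Y°`),
`C′ − B′ ⊆ Y°` and `C′ − A′ ⊆ Z°` with distinct differences, `A′ − B′` distinct; block `i = (P, Q, R)`. [cite: CohnKleinbergSzegedyUmans2005, Def. 5.1] -/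
def realisationsDead (p a₀ b₀ c₀ : ℕ) (P Q R Yo Zo : List ℕ) : Bool :=
  let yoM := maskOf Yo
  let zoM := maskOf Zo
  (Yo.sublistsLen c₀).all fun C' =>
    let candB := (List.range p).filter fun β => C'.all fun cc => tb yoM ((cc + p - β) % p)
    !(candB.elem 0) ||
      (((candB.filter fun x => !(Nat.beq x 0)).sublistsLen (b₀ - 1)).all fun B1 =>
        let B' := 0 :: B1
        let D := C'.flatMap fun cc => B'.map fun β => (cc + p - β) % p
        !(decide D.Nodup) ||
          (let candA := (List.range p).filter fun α => C'.all fun cc => tb zoM ((cc + p - α) % p)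
           (candA.sublistsLen a₀).all fun A' =>
             let DZ := C'.flatMap fun cc => A'.map fun α => (cc + p - α) % p
             !(decide DZ.Nodup) ||
               (let X := A'.flatMap fun α => B'.map fun β => (α + p - β) % p
                !(decide X.Nodup) || !(isSTPPb p [(P, Q, R), (A', B', C')]))))

/-! ## §2 Patterns, translates, the tiling loop -/

/-- The pattern `P + Q` as a residue list. [folklore] -/
def pattPQ (p : ℕ) (P Q : List ℕ) : List ℕ := P.flatMap fun x => Q.map fun q => (x + q) % p

/-- The translate masks `(r, mask of r − patt)` for `r < p`, in increasing order of `r`. [folklore] -/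
def transMasks (p : ℕ) (patt : List ℕ) : List (ℕ × ℕ) := (List.range p).map fun r => (r, maskOf (patt.map fun y => (r + p - y) % p))

/-- The interval masks `(s, mask of [s, s + len) mod p)`, `s < p`. [folklore] -/
def ivlMasks (p len : ℕ) : List (ℕ × ℕ) := (List.range p).map fun s => (s, maskOf ((List.range len).map fun t => (s + t) % p))

/-- **The tiling loop.**  Choose `k` more translates from `rest` (in order, i.e. increasing positions), each disjoint from the current cover `cov`, then
evaluate `leaf chosen cov`; conjunction over all choices. [folklore] -/
def tilesAll (leaf : List ℕ → ℕ → Bool) : ℕ → List (ℕ × ℕ) → List ℕ → ℕ → Bool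
  | 0, _, chosen, cov => leaf chosen cov
  | _ + 1, [], _, _ => true
  | k + 1, (r, m) :: rest, chosen, cov =>
    (cond (disjB m cov) (tilesAll leaf k rest (chosen ++ [r]) (cov ||| m)) true) && tilesAll leaf (k + 1) rest chosen cov

/-! ## §3 Case A (and B′ by role swap) -/

/-- **Case A is dead for the free shape `Q`** (`b = Q.length`, `0 ∈ Q`; one other block `(a₀, b₀, c₀)`, `L = b₀c₀`, `z = a₀c₀`): for every interval
position `s0` with `SY = [s0, s0 + a + L − 1)` disjoint from the translate `0 − (P + Q)`, every tiling `R′ ∋ 0` of `W` avoiding `SY`, every `z`-subset `Z°`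
of `Zc = ⋂_{q ∈ Q} (Tfree + q)` (`Tfree = univ ∖ (W ∪ SY)`), no realisation of block `0` completes an STPP family.
[cite: CohnKleinbergSzegedyUmans2005, Def. 5.1] [cite: Vosper1956, main theorem; Nathanson1996, Thm 2.7] -/
def caseADeadQ (p a c L z a₀ b₀ c₀ : ℕ) (Q : List ℕ) : Bool :=
  let is := List.range p
  let P := List.range a
  let patt := pattPQ p P Q
  !(decide patt.Nodup) ||
    (let masks := transMasks p patt
     let T0 := (masks.headD (0, 0)).2
     let rest := masks.drop 1
     (ivlMasks p (a + L - 1)).all fun ssm =>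
       !(disjB ssm.2 T0) ||
         tilesAll (fun R cov =>
             let tfree := fullMask p ^^^ cov
             let zc := Q.foldl (fun m q => m &&& rot p tfree q) (fullMask p)
             !(Nat.ble z (popc is zc)) ||
               (let Yo := (List.range L).map fun t => (ssm.1 + a - 1 + t) % p
                ((members is zc).sublistsLen z).all fun Zo => realisationsDead p a₀ b₀ c₀ P Q R Yo Zo))
           (c - 1) rest [0] (T0 ||| ssm.2))

/-! ## §4 Case C -/

/-- `Q`-shapes of case C: `[0, b] ∖ {h}`, `h ∈ [1, b]` (Hamidoune–Rødseth side of difference `1`, first element `0`).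
[cite: HamidouneRodseth2000, main theorem (§1, p. 252)] -/
def qShapesC (b : ℕ) : List (List ℕ) := (List.range' 1 b).map fun h => (List.range (b + 1)).filter fun x => !(Nat.beq x h)

/-- `P`-shapes of case C: `d · ([0, a] ∖ {h})`, `d ∈ [1, p)`, `h ∈ [1, a]` (`a ≥ 3`), resp. `{0, d}` (`a = 2`). [cite: HamidouneRodseth2000, main theorem (§1, p. 252)] -/
def pShapesC (p a : ℕ) : List (List ℕ) :=
  if a ≤ 2 then (List.range' 1 (p - 1)).map fun d => [0, d]
  else (List.range' 1 (p - 1)).flatMap fun d => (List.range' 1 a).map fun h =>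
    ((List.range (a + 1)).filter fun x => !(Nat.beq x h)).map fun k => (d * k) % p

/-- **Case C is dead for the shapes `(Q, P)`**: for every tiling `R′ ∋ 0` of `W`, every `Z° =` a `(z+1)`-interval minus one point inside `Zc = ⋂_{q∈Q}(free + q)`
with `#(−Q + Z°) = b + z`, `SY := free ∖ T`, every `L`-subset `Y°` of `⋂_{x∈P}(SY + x)` with `−P + Y° = SY`, no realisation of block `0` completes an STPP family.
[cite: CohnKleinbergSzegedyUmans2005, Def. 5.1] [cite: HamidouneRodseth2000, main theorem (§1, p. 252)] -/
def caseCDeadQP (p c L z a₀ b₀ c₀ : ℕ) (Q P : List ℕ) : Bool :=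
  let is := List.range p
  let b := Q.length
  let patt := pattPQ p P Q
  !(decide patt.Nodup) ||
    (let masks := transMasks p patt
     let T0 := (masks.headD (0, 0)).2
     let rest := masks.drop 1
     tilesAll (fun R cov =>
         let free := fullMask p ^^^ cov
         let zc := Q.foldl (fun m q => m &&& rot p free q) (fullMask p)
         (List.range p).all fun z0 =>
           let ivl := (List.range (z + 1)).map fun t => (z0 + t) % p
           let miss := ivl.filter fun x => !(tb zc x)
           !(Nat.ble miss.length 1) ||
             (cond (Nat.beq miss.length 0) ivl miss).all fun hx =>
               let Zo := ivl.filter fun x => !(Nat.beq x hx)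
               let tM := Q.foldl (fun m q => m ||| rot p (maskOf Zo) (p - q)) 0
               !(Nat.beq (popc is tM) (b + z)) ||
                 (let sy := free ^^^ tM
                  let yc := P.foldl (fun m x => m &&& rot p sy x) (fullMask p)
                  !(Nat.ble L (popc is yc)) ||
                    ((members is yc).sublistsLen L).all fun Yo =>
                      let syM := P.foldl (fun m x => m ||| rot p (maskOf Yo) (p - x)) 0
                      !(Nat.beq syM sy) || realisationsDead p a₀ b₀ c₀ P Q R Yo Zo))
       (c - 1) rest [0] T0)

/-! ## §5 Free shapes and their symmetry quotient -/

/-- All `b`-element shapes `∋ 0`: `0 :: q`, `q` a `(b−1)`-sublist of `[1, p)`; entries `lo ≤ index < hi`. [folklore] -/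
def qShapes (p b lo hi : ℕ) : List (List ℕ) :=
  ((((List.range' 1 (p - 1)).sublistsLen (b - 1)).map fun q => 0 :: q).drop lo).take (hi - lo)

/-- Lexicographic `≤` on lists of naturals (`Bool`). [folklore] -/
def lexLE : List ℕ → List ℕ → Bool
  | [], _ => true
  | _ :: _, [] => false
  | x :: xs, y :: ys => cond (Nat.blt x y) true (cond (Nat.beq x y) (lexLE xs ys) false)

/-- All sequences of `k` parts, each `≥ lo`, with sum `n`. [folklore] -/
def comps (lo : ℕ) : ℕ → ℕ → List (List ℕ)
  | 0, n => cond (Nat.beq n 0) [[]] []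
  | k + 1, n => ((List.range (n + 1)).filter fun g => Nat.ble lo g).flatMap fun g => (comps lo k (n - g)).map fun rest => g :: rest

/-- The cyclic rotations of a list. [folklore] -/
def rotations (l : List ℕ) : List (List ℕ) := (List.range l.length).map fun i => l.drop i ++ l.take i

/-- Bracelet-canonical gap sequence: `≤` every rotation of itself and of its reversal. [folklore] -/
def braceletCanon (g : List ℕ) : Bool :=
  (rotations g).all (fun r => lexLE g r) && (rotations g.reverse).all (fun r => lexLE g r)

/-- The shape (prefix sums `0, g₁, g₁ + g₂, …`, total dropped) of a gap sequence. [folklore] -/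
def shapeOfGaps (g : List ℕ) : List ℕ := ((g.dropLast).foldl (fun acc x => (acc.1 ++ [acc.2 + x], acc.2 + x)) ([0], 0)).1

/-- **Canonical `b`-element shapes of `ℤ/p` with smallest gap `g1`**: shapes of the bracelet-canonical gap sequences `(g1, g₂, …, g_b)`, `gᵢ ≥ g1`, `Σ = p`.
Rotating a shape = choosing another element of `Bᵢ` as `0`; reversing = the automorphism `x ↦ −x`. [folklore] -/
def canonShapes (p b g1 : ℕ) : List (List ℕ) :=
  (((comps g1 (b - 1) (p - g1)).map fun rest => g1 :: rest).filter braceletCanon).map shapeOfGaps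

/-! ## §6 Soundness pieces: the tiling loop is complete -/

/-- Sequential admissibility of a list of (position, mask) choices from the cover `cov`: each mask is disjoint from the cover accumulated before it. [folklore] -/
def admissible : ℕ → List (ℕ × ℕ) → Bool
  | _, [] => true
  | cov, x :: rs => disjB x.2 cov && admissible (cov ||| x.2) rs

/-- **Completeness of the tiling loop.**  If `rs` is a sublist of `rest` (choices in increasing position), sequentially admissible from `cov`, and `leaf`
FAILS at the state it leads to, then `tilesAll leaf rs.length rest chosen cov = false`.  (So `tilesAll … = true` certifies that `leaf` holds at every
admissible tiling — the form in which the slack-2 law consumes the checker.) [folklore] -/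
theorem tilesAll_complete (leaf : List ℕ → ℕ → Bool) :
    ∀ (rest rs : List (ℕ × ℕ)) (chosen : List ℕ) (cov : ℕ), rs.Sublist rest → admissible cov rs = true →
      leaf (chosen ++ rs.map Prod.fst) (rs.foldl (fun c x => c ||| x.2) cov) = false →
      tilesAll leaf rs.length rest chosen cov = false := by
  intro rest
  induction rest with
  | nil =>
    intro rs chosen cov hsub _ hleaf
    obtain rfl := List.sublist_nil.1 hsub
    simpa [tilesAll] using hleaf
  | cons y rest ih =>
    intro rs chosen cov hsub hadm hleaf
    obtain ⟨r, m⟩ := y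
    cases hsub with
    | cons _ h =>
      rcases rs with _ | ⟨x, rs'⟩
      · simpa [tilesAll] using hleaf
      · rw [List.length_cons, tilesAll, Bool.and_eq_false_iff]
        exact Or.inr (ih (x :: rs') chosen cov h hadm hleaf)
    | cons_cons _ h =>
      rename_i rs₁
      rw [List.length_cons, tilesAll, Bool.and_eq_false_iff]
      rw [admissible, Bool.and_eq_true] at hadm
      obtain ⟨hd, hadm'⟩ := hadm
      refine Or.inl ?_
      rw [show disjB ((r, m).2) cov = disjB m cov from rfl] at hd
      rw [hd, cond_true]
      refine ih rs₁ (chosen ++ [r]) (cov ||| m) h hadm' ?_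
      simpa [List.foldl_cons, List.map_cons, List.append_assoc] using hleaf

/-- The loop with NO admissible continuation of full length is vacuously `true`; with `k = 0` it is the leaf. [folklore] -/
theorem tilesAll_zero (leaf : List ℕ → ℕ → Bool) (rest : List (ℕ × ℕ)) (chosen : List ℕ) (cov : ℕ) :
    tilesAll leaf 0 rest chosen cov = leaf chosen cov := by
  cases rest <;> rfl

/-! ## §7 Soundness pieces: Def 5.1 in values -/

/-- **`isSTPPb` is sound**: if every value list of `bl` consists of values of the corresponding set of an STPP family `(A, B, C)` in `ℤ/p`
(block `i` of `bl` ↔ index `i`), then `isSTPPb p bl = true`. [cite: CohnKleinbergSzegedyUmans2005, Def. 5.1] -/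
theorem isSTPPb_of_isSTPP {p : ℕ} [Fact p.Prime] {N : ℕ} {A B C : Fin N → Finset (ZMod p)}
    (hS : Literature.Computability.AlgebraicComplexity.IsSTPP A B C) (bl : List (List ℕ × List ℕ × List ℕ)) (hn : bl.length = N)
    (hA : ∀ (i : Fin N) (x : ℕ), x ∈ (bl.getD i.val ([], [], [])).1 → ∃ a ∈ A i, a.val = x)
    (hB : ∀ (i : Fin N) (x : ℕ), x ∈ (bl.getD i.val ([], [], [])).2.1 → ∃ b ∈ B i, b.val = x)
    (hC : ∀ (i : Fin N) (x : ℕ), x ∈ (bl.getD i.val ([], [], [])).2.2 → ∃ c ∈ C i, c.val = x) :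
    isSTPPb p bl = true := by
  unfold isSTPPb
  simp only [List.all_eq_true, List.mem_range, Bool.or_eq_true, Bool.not_eq_true', Bool.and_eq_true, Nat.beq_eq]
  intro i hi j hj k hk s hs s' hs' t ht t' ht' u hu u' hu'
  rw [hn] at hi hj hk
  obtain ⟨a, ha, rfl⟩ := hA ⟨k, hk⟩ s hs
  obtain ⟨a', ha', rfl⟩ := hA ⟨i, hi⟩ s' hs'
  obtain ⟨b, hb, rfl⟩ := hB ⟨i, hi⟩ t ht
  obtain ⟨b', hb', rfl⟩ := hB ⟨j, hj⟩ t' ht'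
  obtain ⟨c, hc, rfl⟩ := hC ⟨j, hj⟩ u hu
  obtain ⟨c', hc', rfl⟩ := hC ⟨k, hk⟩ u' hu'
  by_cases h0 : (a'.val + b'.val + c'.val + 3 * p - a.val - b.val - c.val) % p = 0
  · right
    have hav := a.val_lt
    have hbv := b.val_lt
    have hcv := c.val_lt
    have hz : ((a'.val + b'.val + c'.val + 3 * p - a.val - b.val - c.val : ℕ) : ZMod p) = 0 :=
      (CharP.cast_eq_zero_iff (ZMod p) p _).2 (Nat.dvd_of_mod_eq_zero h0)
    have hsum : (a' - a) + (b' - b) + (c' - c) = 0 := by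
      have h3 : ((a'.val + b'.val + c'.val + 3 * p - a.val - b.val - c.val : ℕ) : ZMod p) =
          (a'.val : ZMod p) + b'.val + c'.val + 3 * (p : ZMod p) - a.val - b.val - c.val := by
        rw [Nat.cast_sub (by omega), Nat.cast_sub (by omega), Nat.cast_sub (by omega)]
        push_cast
        ring
      rw [h3, ZMod.natCast_self, mul_zero, add_zero, ZMod.natCast_zmod_val, ZMod.natCast_zmod_val, ZMod.natCast_zmod_val,
        ZMod.natCast_zmod_val, ZMod.natCast_zmod_val, ZMod.natCast_zmod_val] at hz
      linear_combination hz
    obtain ⟨hij, hjk, hss, htt, huu⟩ :=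
      (Literature.Computability.AlgebraicComplexity.isSTPP_iff A B C).1 hS ⟨i, hi⟩ ⟨j, hj⟩ ⟨k, hk⟩ a ha a' ha' b hb b' hb' c hc c' hc' hsum
    exact ⟨⟨⟨⟨by simpa using congrArg Fin.val hij, by simpa using congrArg Fin.val hjk⟩, by rw [hss]⟩, by rw [htt]⟩, by rw [huu]⟩
  · left
    exact Bool.eq_false_iff.2 fun hb => h0 (Nat.eq_of_beq_eq_true hb)

/-! ## §8 Soundness pieces: the realisation stage examines every admissible realisation -/

/-- **The realisation stage is exhaustive** (control flow only): if `realisationsDead … = true`, then for ANY `C′` among the `c₀`-sublists of `Yo`, with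
`0` a `B`-candidate, any `B1` among the `(b₀−1)`-sublists of the non-zero `B`-candidates with `C′ − (0 :: B1)` duplicate-free, and any `A′` among the
`a₀`-sublists of the `A`-candidates with `C′ − A′` and `A′ − (0 :: B1)` duplicate-free, the value family `[(P, Q, R), (A′, 0 :: B1, C′)]` FAILS `isSTPPb`.
(The law's soundness proof feeds the true block `0`, written as these filters, and `isSTPPb_of_isSTPP`.) [cite: CohnKleinbergSzegedyUmans2005, Def. 5.1] -/
theorem isSTPPb_false_of_realisationsDead {p a₀ b₀ c₀ : ℕ} {P Q R Yo Zo : List ℕ} (h : realisationsDead p a₀ b₀ c₀ P Q R Yo Zo = true)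
    (C' B1 A' : List ℕ) (hC' : C' ∈ Yo.sublistsLen c₀)
    (h0 : (0 : ℕ) ∈ (List.range p).filter fun β => C'.all fun cc => tb (maskOf Yo) ((cc + p - β) % p))
    (hB1 : B1 ∈ (((List.range p).filter fun β => C'.all fun cc => tb (maskOf Yo) ((cc + p - β) % p)).filter fun x => !(Nat.beq x 0)).sublistsLen (b₀ - 1))
    (hD : (C'.flatMap fun cc => (0 :: B1).map fun β => (cc + p - β) % p).Nodup)
    (hA' : A' ∈ ((List.range p).filter fun α => C'.all fun cc => tb (maskOf Zo) ((cc + p - α) % p)).sublistsLen a₀)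
    (hDZ : (C'.flatMap fun cc => A'.map fun α => (cc + p - α) % p).Nodup)
    (hX : (A'.flatMap fun α => (0 :: B1).map fun β => (α + p - β) % p).Nodup) :
    isSTPPb p [(P, Q, R), (A', 0 :: B1, C')] = false := by
  unfold realisationsDead at h
  simp only [List.all_eq_true, Bool.or_eq_true, Bool.not_eq_true'] at h
  have h1 := h C' hC'
  rcases h1 with h1 | h1
  · exact absurd (List.elem_eq_true_of_mem h0) (by rw [h1]; exact Bool.false_ne_true)
  have h2 := h1 B1 hB1
  rcases h2 with h2 | h2
  · exact absurd hD (of_decide_eq_false h2)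
  have h3 := h2 A' hA'
  rcases h3 with h3 | h3
  · exact absurd hDZ (of_decide_eq_false h3)
  rcases h3 with h3 | h3
  · exact absurd hX (of_decide_eq_false h3)
  exact h3

/-! ## §9 Soundness pieces: case A examines every admissible (interval, tiling, Z°) — the leaf named, and the outer loops exhausted -/

/-- The leaf of the case-A loop, NAMED (same text as inside `caseADeadQ`): at the tiling `R` with cover `cov` (= `W ∪ SY`), the `Z°`-candidate mask and
the realisation stage for every `z`-subset of it. [cite: CohnKleinbergSzegedyUmans2005, Def. 5.1] -/
def caseALeaf (p a L z a₀ b₀ c₀ : ℕ) (Q : List ℕ) (s0 : ℕ) (R : List ℕ) (cov : ℕ) : Bool :=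
  let tfree := fullMask p ^^^ cov
  let zc := Q.foldl (fun m q => m &&& rot p tfree q) (fullMask p)
  !(Nat.ble z (popc (List.range p) zc)) ||
    (let Yo := (List.range L).map fun t => (s0 + a - 1 + t) % p
     ((members (List.range p) zc).sublistsLen z).all fun Zo => realisationsDead p a₀ b₀ c₀ (List.range a) Q R Yo Zo)

/-- Case A over the named leaf. [cite: CohnKleinbergSzegedyUmans2005, Def. 5.1] -/
def caseADeadQ' (p a c L z a₀ b₀ c₀ : ℕ) (Q : List ℕ) : Bool :=
  let patt := pattPQ p (List.range a) Q
  !(decide patt.Nodup) ||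
    (let masks := transMasks p patt
     let T0 := (masks.headD (0, 0)).2
     let rest := masks.drop 1
     (ivlMasks p (a + L - 1)).all fun ssm =>
       !(disjB ssm.2 T0) || tilesAll (caseALeaf p a L z a₀ b₀ c₀ Q ssm.1) (c - 1) rest [0] (T0 ||| ssm.2))

/-- The two spellings agree (definitionally). [folklore] -/
theorem caseADeadQ'_eq (p a c L z a₀ b₀ c₀ : ℕ) (Q : List ℕ) : caseADeadQ' p a c L z a₀ b₀ c₀ Q = caseADeadQ p a c L z a₀ b₀ c₀ Q := rfl

/-- **The leaf is exhaustive**: if `caseALeaf … s0 R cov = true` then for every `z`-sublist `Zo` of the members of the candidate mask the realisation stage is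
dead. [cite: CohnKleinbergSzegedyUmans2005, Def. 5.1] -/
theorem realisationsDead_of_caseALeaf {p a L z a₀ b₀ c₀ : ℕ} {Q : List ℕ} {s0 : ℕ} {R : List ℕ} {cov : ℕ}
    (h : caseALeaf p a L z a₀ b₀ c₀ Q s0 R cov = true) (Zo : List ℕ)
    (hZo : Zo ∈ (members (List.range p) (Q.foldl (fun m q => m &&& rot p (fullMask p ^^^ cov) q) (fullMask p))).sublistsLen z) :
    realisationsDead p a₀ b₀ c₀ (List.range a) Q R ((List.range L).map fun t => (s0 + a - 1 + t) % p) Zo = true := by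
  unfold caseALeaf at h
  simp only [Bool.or_eq_true, Bool.not_eq_true', List.all_eq_true] at h
  rcases h with h | h
  · exfalso
    have hlen := (List.mem_sublistsLen.1 hZo)
    have hle := hlen.1.length_le
    rw [hlen.2, ← popc_eq_length_members] at hle
    rw [Nat.ble_eq_true_of_le hle] at h
    exact Bool.noConfusion h
  · exact h Zo hZo

/-- **Case A is exhaustive**: if `caseADeadQ' … Q = true` and the pattern `P + Q` is duplicate-free, then for every interval position `s0 < p` whose interval
mask is disjoint from the translate at `0`, and every sequentially admissible choice `rs` of `c − 1` further translates (a sublist of the remaining ones),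
the leaf holds at the resulting tiling. [cite: CohnKleinbergSzegedyUmans2005, Def. 5.1] -/
theorem caseALeaf_of_caseADeadQ' {p a c L z a₀ b₀ c₀ : ℕ} {Q : List ℕ} (h : caseADeadQ' p a c L z a₀ b₀ c₀ Q = true)
    (hpatt : (pattPQ p (List.range a) Q).Nodup) (ssm : ℕ × ℕ) (hssm : ssm ∈ ivlMasks p (a + L - 1))
    (hdisj : disjB ssm.2 ((transMasks p (pattPQ p (List.range a) Q)).headD (0, 0)).2 = true)
    (rs : List (ℕ × ℕ)) (hsub : rs.Sublist ((transMasks p (pattPQ p (List.range a) Q)).drop 1)) (hlen : rs.length = c - 1)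
    (hadm : admissible (((transMasks p (pattPQ p (List.range a) Q)).headD (0, 0)).2 ||| ssm.2) rs = true) :
    caseALeaf p a L z a₀ b₀ c₀ Q ssm.1 ([0] ++ rs.map Prod.fst)
      (rs.foldl (fun cv x => cv ||| x.2) (((transMasks p (pattPQ p (List.range a) Q)).headD (0, 0)).2 ||| ssm.2)) = true := by
  unfold caseADeadQ' at h
  simp only [hpatt, decide_true, Bool.not_true, Bool.false_or, List.all_eq_true, Bool.or_eq_true, Bool.not_eq_true'] at h
  rcases h ssm hssm with h | h
  · rw [hdisj] at h
    exact Bool.noConfusion h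
  · by_contra hleaf
    rw [Bool.not_eq_true] at hleaf
    have key := tilesAll_complete (caseALeaf p a L z a₀ b₀ c₀ Q ssm.1) _ rs [0] _ hsub hadm hleaf
    rw [hlen, h] at key
    exact Bool.noConfusion key

end Summit.MatrixMultiplication.OmegaCensus.CubeNB.S2
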